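import Summits.BirchSwinnertonDyer.BirchSwinnertonDyer.Theorems.Rank1ResidualX9Defs
import Literature.NumberTheory.EllipticCurves.Rank1Residual.HeightLValueMatch
import HarnessLib
import HarnessLib.Audit

/-!
# REGULAR-PRIME and HEIGHT / L-VALUE MATCH CRITERIA on class X9 — the descent lens's class-level
# candidates desc-C5 `RegularPrimeX9R1`, desc-C6 `MatchX9R1`, desc-C7 `MatchX9R0`, desc-C7′
# `DescentMatchX9`, filed as obligation nodes (`@[conjecture] def`: typed ≠ proved; nothing asserted)

HONEST FRAMING (cell `bsd-f3-mu`, D-0131 (3) FRONTIER TIER, HOME `run/shared/lean/pub/bsd-f3-mu/`).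
TYPER's filing of the `-desc` lens's generation-4/5 statements (MEMO-desc §12 «the REGULAR-PRIME / MATCH
certificate», §13 «DESCENT CLOSES THE Ш-GATE»; `HOME/desc/Sketch7.lean` sha16 433aa2f37f3eda0d, rc 0),
VERBATIM over the Literature carriers `Rank1Residual.RegularPrimeAt`, `Rank1Residual.HeightLValueMatchAt`,
`Rank1Residual.ShaPTorsionFreeAt` (`Rank1Residual/HeightLValueMatch.lean`, `…/FineMordellWeilCertificates.lean`).
Refuter `-ref1` (REF1-AUDIT §3.7 seventh pass, §3.9 eighth pass): all four SURVIVE, CONJECTURE-GRADE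
(each ⟸ BSD, resp. `p`-adic BSD + Schneider); BC7 CLEAN 4/4 + 4/4 (vs the leaf `BSDpOnClassX9` and vs the
crux `KatoDivisibilityX9`, stmt-20547); triviality / vacuity probes fail; KILLED 0.  Refuter `-ref2` g7
(REF2-LITMAP row desc-§13): the descent ENGINE is in print (Schaefer–Stoll 2004; Miller 2011 §6–§7, where
`BSD_p` is already published on 30 X9 + 52 X10b rows of conductor `< 5000`); the class-wide statements are
not in print.  A pure CONJECTURE LEAF; the kernel glue (each candidate ⟹ the crux `KatoDivisibilityAt` on
its rows; cover engines to the node) is in `HeightLValueMatchCriteriaEdges.lean`.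

WHAT THEY SAY.  Modulo the named facts {Perrin-Riou–Schneider `Schneider1985_order_charGenerator`, the
canonical height facts, BCS 2025 Thm. 1.1.2 (a), modularity, GZK}: desc-C5 ⟺ `μ(X(E/ℚ_∞)) = 0` on the
rank-1 `λ_an = 1` X9 rows (= the crux restricted, in `L`-free dress); desc-C6 ⟺ (`k = 0` ∧ Schneider) on
the rank-1 `p ∤ #Ш[p^∞]` rows (= 20547 ∧ 19631 restricted, numerics-decidable dress); desc-C7 = (the
`p`-part of BSD at rank 0) ∧ (a rank-0 `p`-converse: the conclusion contains `L_p(f,α)(0) ≠ 0`, i.e.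
`L(E,1) ≠ 0`) on the `Ш[p] = 0` X9 rows in DESCENT-decidable hypotheses (Mordell–Weil rank 0, `Ш[p] = 0`)
— there MATCH ⟺ `v_p #Ш_an = 0` is STRONGER than `KatoDivisibilityAt` (⟺ `v_p #Ш_an ≥ 0`), it is `k = 0`
= the integral main conjecture at the pair; desc-C7′ = C7 ∪ C6 with the rank and the Ш-gate read by descent.
BC5 witnesses (desc censuses, GRH-flagged where so): REGULAR-CENSUS-v1 (415 rank-1 X9 rows; MATCH measured
on 403, `Ш[p] = 0` certified on 313; 0 failures), DESCENT-CENSUS-v1 7f14a39f431ccafa (790 rows: rank 0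
decided on 354 = 75 EXACT + 279 GRH, rank 1 on 400 (MATCH measured on 389); the 14 rank-0 Ш-cells
`dim Ш[p] = 2 = ord_p #Ш_an` correctly OUTSIDE the hypothesis; 0 failures).
PARTITION currency: X9 790 = 130 (5Ns) + 36 (7Ns) + 624 (5S4) (+58 r ≥ 2); r1 415, r0 375.

References: [SteinWuthrich2013] §5.1 Conj. 5.1 (p. 18), §6.1 Thm. 6.1 and the paragraph after it (p. 20),
§8; [Schneider1985] Thm. 2′ (p. 342); [BurungaleCastellaSkinner2025] Thm. 1.1.2 (a); [GreenbergLNM1716] §1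
Conj. 1.11; [Miller2011LMS] Def. 1.1, §6 Ex. 6.4, Thm. 7.1–7.2; [SchaeferStoll2004]; HOME MEMO-desc.md
§12–§13, desc/Sketch7.lean, REF1-AUDIT.md §3.7/§3.9, REF2-LITMAP.md row desc-§13, CANDIDATES.md §1 rows 20–21.
-/

-- the summit and its single problem are both named `BirchSwinnertonDyer` (registry layout D-0017)
set_option linter.dupNamespace false

noncomputable section

open scoped Classical

open WeierstrassCurve Literature.NumberTheory.EllipticCurves
  Summit.BirchSwinnertonDyer.BirchSwinnertonDyer.Rank1Residual
open Literature.NumberTheory.EllipticCurves.Rank1Residual (RegularPrimeAt HeightLValueMatchAt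
  ShaPTorsionFreeAt HasLambdaAnAt)

namespace Summit.BirchSwinnertonDyer.Rank1Residual.SmallImageMu

/-- **desc-C5 `RegularPrimeX9R1` (OPEN; cell candidate; nothing asserted): on class X9 in analytic rank 1,
at a SIMPLE analytic zero (`λ(𝓛_p(E)) = 1`) the prime `p` is REGULAR for `E`** (`Rank1Residual.RegularPrimeAt`:
the Perrin-Riou–Schneider leading-term norm identity at THE canonical height).  Modulo PRS + BCS (a) + GZK
it is EQUIVALENT on those rows to `μ(X(E/ℚ_∞)) = 0` (there `𝔰(E,p) = μ(X)` exactly), i.e. to the crux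
`KatoDivisibilityOnClassX9` restricted to the `λ_an = 1` rank-1 rows in `L`-free dress, and to Greenberg's
Conj. 1.11 there.  Cheapest falsifier: one rank-1 X9 row with `λ_an = 1` and
`v_p(ĥ_p(P₀)) − 1 + v_p(∏c) + v_p(#Ш[p^∞]) + 2v_p(#Ẽ(𝔽_p)) ≥ 1` (census REGULAR-CENSUS-v1: 0/287).
Refuter: SURVIVES — conjecture-grade reformulation (REF1-AUDIT §3.7); BC7 CLEAN.
[cite: SteinWuthrich2013, §6.1 Thm. 6.1 and the paragraph after it (p. 20)] [cite: GreenbergLNM1716, §1 Conj. 1.11] -/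
@[conjecture] def RegularPrimeX9R1 : Prop :=
  ∀ (W : WeierstrassCurve ℚ) [W.IsElliptic] [W.IsGloballyMinimal] (p : ℕ) [Fact p.Prime],
    ClassX9 W p → W.analyticRank = 1 → HasLambdaAnAt W p 1 → RegularPrimeAt W p

/-- **desc-C6 `MatchX9R1` (OPEN; cell candidate; nothing asserted): on class X9 in analytic rank 1,
whenever `p ∤ #Ш(E)[p^∞]` the Ш-free `p`-adic BSD valuation identity MATCH holds**
(`Rank1Residual.HeightLValueMatchAt`).  Modulo PRS + BCS (a) it is EQUIVALENT, row by row, to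
(`k = 0` ∧ Schneider) on the `Ш[p] = 0` rank-1 rows (= crux 20547 ∧ 19631 restricted, numerics-decidable
dress); implied by `p`-adic BSD + Schneider.  Cheapest falsifier: ONE rank-1 X9 row with `Ш[p] = 0`
certified and `v_p([T¹] L_p) ≠ 𝔰'(E,p)` (census: MATCH measured on 403 of 415 rank-1 X9 rows, `Ш[p] = 0`
certified on 313: 0 failures).  Refuter: SURVIVES — conjecture-grade (REF1-AUDIT §3.7); BC7 CLEAN ×2.
[cite: SteinWuthrich2013, §5.1 Conj. 5.1 (p. 18) and §6.1 Thm. 6.1 (p. 20)] [cite: Schneider1985, Thm. 2′ (p. 342)] -/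
@[conjecture] def MatchX9R1 : Prop :=
  ∀ (W : WeierstrassCurve ℚ) [W.IsElliptic] [W.IsGloballyMinimal] (p : ℕ) [Fact p.Prime],
    ClassX9 W p → W.analyticRank = 1 →
      ¬ p ∣ Nat.card (AddCommGroup.primaryComponent W.sha p) → HeightLValueMatchAt W p

/-- **desc-C7 `MatchX9R0` (OPEN; cell candidate; nothing asserted): on class X9 at Mordell–Weil rank 0, a
`p`-descent certifying `Ш(E/ℚ)[p] = 0` (`Rank1Residual.ShaPTorsionFreeAt`) forces MATCH** — at rank 0
(`Reg_p = 1`, `Rank1Residual.heightLValueMatchAt_iff_of_rank_zero`) the exact identity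
`L_p(f,α)(0) ≠ 0 ∧ ‖L_p(f,α)(0)‖·‖#tors²‖ = ‖(1 − α⁻¹)² ∏ c_ℓ‖`, i.e. `v_p(L(E,1)/Ω_E) = v_p(∏ c_ℓ) − 2v_p(#tors)`
(`ord_p #Ш_an = 0`).  Content: the `p`-part of BSD at the rank-0 `Ш[p]`-trivial X9 pairs TOGETHER WITH a
rank-0 `p`-converse (`L(E,1) ≠ 0` from Mordell–Weil rank 0 + `Ш[p] = 0`), in descent-decidable
hypotheses; there MATCH (`v_p #Ш_an = 0`, = `k = 0` = the integral main conjecture at the pair) is STRONGER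
than the crux `KatoDivisibilityAt` (`v_p #Ш_an ≥ 0`), which it implies (edges file).  ⟸ BSD.  BC5 witness:
DESCENT-CENSUS-v1 (375 rank-0 X9 rows: `Ш[p] = 0` certified by descent on 354 — 75 EXACT, 279 GRH — with
`ord_p #Ш_an = 0` on exactly those + 7 uncertified; the 14 rows with `dim Ш[p] = 2 = ord_p #Ш_an` lie
outside the hypothesis; 0 failures).  Cheapest falsifier: ONE rank-0 X9 row with `dim Sel_p(E/ℚ) = 0` and
`v_p(L(E,1)/Ω_E) ≠ v_p(∏ c_ℓ)`.  Refuter: SURVIVES — conjecture-grade (REF1-AUDIT §3.9); BC7 CLEAN 2/2.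
[cite: Miller2011LMS, Def. 1.1, §6 Example 6.4 and Thm. 7.1–7.2] [cite: SteinWuthrich2013, §5.1 Conj. 5.1 (p. 18), §8] -/
@[conjecture] def MatchX9R0 : Prop :=
  ∀ (W : WeierstrassCurve ℚ) [W.IsElliptic] [W.IsGloballyMinimal] (p : ℕ) [Fact p.Prime],
    ClassX9 W p → W.mordellWeilRank = 0 → ShaPTorsionFreeAt W p → HeightLValueMatchAt W p

/-- **desc-C7′ `DescentMatchX9` (OPEN; cell candidate; nothing asserted): on class X9 at Mordell–Weil rank
`≤ 1`, a `p`-descent certifying `Ш(E/ℚ)[p] = 0` forces MATCH** — desc-C7 ∪ desc-C6 with the rank and the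
Ш-gate read by DESCENT instead of GZK/Heegner.  ⟸ BSD + `p`-adic BSD + Schneider.  BC5 witness:
DESCENT-CENSUS-v1 (790 rows: decided on 354 rank-0 + 400 rank-1 rows (MATCH measured on 389 of them), 0
failures).  Refuter: SURVIVES — conjecture-grade (REF1-AUDIT §3.9); BC7 CLEAN 2/2.
[cite: Miller2011LMS, Def. 1.1, §6 and Thm. 7.1–7.2] [cite: SteinWuthrich2013, §5.1 Conj. 5.1 (p. 18), §6.1 Thm. 6.1 (p. 20)] -/
@[conjecture] def DescentMatchX9 : Prop :=
  ∀ (W : WeierstrassCurve ℚ) [W.IsElliptic] [W.IsGloballyMinimal] (p : ℕ) [Fact p.Prime],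
    ClassX9 W p → W.mordellWeilRank ≤ 1 → ShaPTorsionFreeAt W p → HeightLValueMatchAt W p

end Summit.BirchSwinnertonDyer.Rank1Residual.SmallImageMu

end
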